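/-
Copyright (c) 2026 the pub-hodgecm-mathlib formalisation cell (harness21).  Prover seat hodgecm-mathlib-K2E4-p09 (g2), Track B «K2-LIT» ∕ h413
(`stmt-HodgeConjecture-24833`), line `K2_E3_EllipticInputs`, unit U3b, ROAD J of ‹S_loc›, letter ‹J3› v2 «rank-one mass», road R3, brick F5-idx:
THE EP INDICES `[K:I] = [K′:I] = q_v + 1` OF `U(Φ₂)_v` AT AN UNRAMIFIED NON-SPLIT PLACE, AND LETTER E OF THE (u)-ASSEMBLY.  2026-09-04.
-/
import Summits.HodgeConjecture.HodgeConjecture.Theorems.K2E3EPConstantIndexFormUnramified   -- ★ F5 p856549 (this seat): `exists_epDatum_indexForm_of_unramified` (r pinned in index form)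
import Literature.NumberTheory.Automorphic.SelfDualLatticeCountFrameTransportCM             -- ★ `valued_toPlace_uniformizer`, `toPlace_uniformizer_ne_zero`, `galAdicCompletionMap_toPlace_self` (the σ_w-fixed uniformiser)
import HarnessLib

/-!
# K2_E3 road (h413), U3b ROAD J, letter ‹J3› v2, road R3 — brick F5-idx: THE STAR OF THE TREE OF `U(1,1)` HAS `q_v + 1` EDGES AT BOTH ENDS OF AN EDGE:
# `[K : I] = [K′ : I] = q_v + 1` for `K = U(Φ₂)(𝒪_v)`, `K′ = Ad_d K`, `I = K ⊓ K′`; hence LETTER E `r · ν₂(K) = q_v − 1` (Serre, Trees II.1.1; Kottwitz 1988 §2)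

Cell `pub/hodgecm-mathlib` (D-0151), Track B, squad K2; road owner K2E3-p15 (g2)'s (u)-assembly skeleton `SKELETON-J3u-inert` S1 «INPUT LETTER E (owner K2E4-p09)»:
`∃ f₂ r, IsLocSmooth f₂ ∧ ‹1 on regular elliptic› ∧ ‹0 on regular non-elliptic› ∧ ‹f₂(b·1) = −r› ∧ r · (ν₂ ↑K₂).toReal = q − 1` (`K₂ = cmLocalIntegralLevel L 2 Φ₂ v`, `q = |𝓞_{L⁺}∕v|`).
★ F5 pins `r · ν(K) = [K:I]·(1 − [K:I]⁻¹ − [K′:I]⁻¹)` with `Subgroup.relIndex` indices; this file EVALUATES them.  `[K : I]`: along the one-place model `e_w : U(Φ₂)_v ≃ U_w`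
(★ `localNonsplitEquiv`) `K`, `I` pull back `K_U = U_w ∩ GL₂(𝒪_w)`, `I_U = U_w ∩ Iwahori` (★ `mem_localIntegralLevel_iff_of_smul_eq`, ★ `mem_cmLocalIntegralLevel_inf_map_iff`), and
`[K_U : I_U] = #{t ∈ 𝓀_w : t̄ = −t} + 1 = q_v + 1` is the star of the hyperspecial vertex (★ `natCard_unitaryTwo_star`, ★ `natCard_antifixed_residueField_eq`).  `[K′ : I]`: `K′ = ψK`,
`ψ = Ad_d` (★ `cmDatumLocalNonsplitCongr`), so `[ψK : K ⊓ ψK] = [K : ψ⁻¹K ⊓ K]`, and `ψ⁻¹K ⊓ K = w₀ I w₀⁻¹` (`w₀ = Φ₂ ∈ K`) because `P = w₀d` has `P² = ϖ·1` CENTRAL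
(`Ad_{P⁻¹} = Ad_P`).  GUARD-FREE (only `Algebra.IsUnramifiedIn (𝓞 L) v`): the inert dyadic places are included.
§0 group∕matrix one-liners; §1 `relIndex_iwahori_subgroupOf_glInt_subgroupOf_eq` (`[K_U : I_U] = q_v + 1` at one place); §2 **`relIndex_inf_map_level_eq`** (`[K : I]`),
`conj_weylDiag_mem_glInt_iff` (the `P²`-central trick), `comap_congr_level_inf_eq_map_conj`, **`relIndex_inf_map_congrLevel_eq`** (`[K′ : I]`); §3 `exists_epDatum_of_unramified'`
(explicit `ϖ`, with `0 < r`) and **`exists_epDatum_of_unramified`** — LETTER E verbatim (`r · (ν ↑K).toReal = (q : ℝ) − 1`; the `σ_w`-fixed uniformiser chosen inside).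
THEOREMS ONLY; lane `--supports stmt-HodgeConjecture-24833 --as helper`.  HONEST LABEL: HC_CM is proved only modulo the 7 printed citations (2 remaining named inputs:
hLiu418 = stmt-HodgeConjecture-24832, h413 = stmt-HodgeConjecture-24833) until rung 0 closes; count-neutral helper (‹J3› is proved only when (u)+(r)+(d) land).

## References
* [Serre1980Trees] J.-P. Serre, *Trees* (1980), Ch. II §1.1 (the tree of `SL₂` over a local field: every vertex has `q + 1` neighbours).
* [Kottwitz1988] R. E. Kottwitz, *Tamagawa numbers*, Ann. of Math. 127 (1988) 629–646, §2 Theorem 2 (the Euler–Poincaré function; `[K_σ : I]`).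
* [IwahoriMatsumoto1965] N. Iwahori, H. Matsumoto, Publ. Math. IHÉS 25 (1965), §2 Prop. 2.4 (`GL₂(𝒪) ∩ d GL₂(𝒪) d⁻¹ = I`).
* [Rogawski1990] J. D. Rogawski, *Automorphic Representations of Unitary Groups in Three Variables*, Ann. of Math. Stud. 123 (1990), §8.1 p. 117; §12.6 p. 174.
-/

set_option autoImplicit false
set_option linter.dupNamespace false  -- the mandated namespace repeats the summit's segment, as in every `Theorems/*.lean` here

noncomputable section
open scoped ValuativeRel Matrix MatrixGroups ENNReal NNReal
open Matrix NumberField IsDedekindDomain MulAction MeasureTheory Measure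

namespace Summit.HodgeConjecture.HodgeConjecture.Cruxes.H413.K2E3EPIndicesUnramified

open Literature.NumberTheory.Rogawski1990 Literature.MeasureTheory.Group
open Literature.NumberTheory.Automorphic Literature.NumberTheory.Automorphic.UnitaryGroup Literature.NumberTheory.GaloisRepresentations
open Literature.NumberTheory.Automorphic.HermitianLatticeTree (mem_glInt_iff_forall_v_le_one_and_v_det_eq_one)
open Summit.HodgeConjecture.HodgeConjecture.Cruxes.H413.K2E3EPValueIndexForm Summit.HodgeConjecture.HodgeConjecture.Cruxes.H413.K2E3EPConstantIndexFormUnramified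

/-! ## §0 Group-theory and matrix one-liners -/

section Group

variable {G G' : Type*} [Group G] [Group G']
/-- If `P²` is central then `Ad_{P⁻¹} = Ad_P`: `P⁻¹ X P = P X P⁻¹`. [cite: Serre1980Trees, Ch. II §1.1] -/
theorem conj_inv_eq_conj_of_sq_comm {P : G} (hP : ∀ X : G, P * P * X = X * (P * P)) (X : G) : P⁻¹ * X * P = P * X * P⁻¹ :=
  calc P⁻¹ * X * P = P⁻¹ * (X * (P * P)) * P⁻¹ := by group
    _ = P⁻¹ * (P * P * X) * P⁻¹ := by rw [hP]
    _ = P * X * P⁻¹ := by group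

/-- `g K g⁻¹ = K` for `g ∈ K`. [cite: Serre1980Trees, Ch. II §1.1] -/
theorem map_conj_eq_self_of_mem (K : Subgroup G) {g : G} (hg : g ∈ K) : K.map (MulAut.conj g).toMonoidHom = K := by
  ext x
  rw [Literature.GroupTheory.mem_map_conj_iff, Subgroup.mul_mem_cancel_right K hg, Subgroup.mul_mem_cancel_left K (K.inv_mem hg)]

/-- A surjective homomorphism preserves relative indices of pulled-back subgroups. [cite: Serre1980Trees, Ch. II §1.1] -/
theorem relIndex_comap_of_surjective {f : G →* G'} (hf : Function.Surjective f) (A B : Subgroup G') :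
    (A.comap f).relIndex (B.comap f) = A.relIndex B := by
  rw [Subgroup.relIndex_comap, Subgroup.map_comap_eq_self_of_surjective hf]

end Group

section Matrix

variable {F : Type*} [Field F]
/-- `(w₀ d)² = (ab)·1` for `w₀ = !![0,1;1,0]`, `d = diag(a, b)`. [cite: Serre1980Trees, Ch. II §1.1] -/
theorem antidiag_mul_diagonal_mul_self (a b : F) :
    (!![(0 : F), 1; 1, 0] : Matrix (Fin 2) (Fin 2) F) * Matrix.diagonal ![a, b] * ((!![(0 : F), 1; 1, 0] : Matrix (Fin 2) (Fin 2) F) * Matrix.diagonal ![a, b]) =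
      (a * b) • (1 : Matrix (Fin 2) (Fin 2) F) := by
  ext i j; fin_cases i <;> fin_cases j <;> simp [Matrix.mul_apply, Fin.sum_univ_two, Matrix.vecMul_diagonal, mul_comm]

end Matrix

/-! ## §1 One place `w`: the star of the hyperspecial vertex of `U_w = U(σ_w, Φ₂)(L_w)` has `q_v + 1` edges -/

section OnePlace

variable (L : Type) [Field L] [NumberField L] [IsCMField L] {v : HeightOneSpectrum (𝓞 ↥(maximalRealSubfield L))}
  (w : PlacesOver L v) (hw : IsCMField.complexConj L • w.1 = w.1)

include hw in
/-- **`[K_U : I_U] = q_v + 1`** at a place `v` unramified and non-split in `L` (`w ∣ v`, `w̄ = w`): `K_U = U_w ∩ GL₂(𝒪_w)`, `I_U = U_w ∩ Iwahori`; the residual data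
(`σ_w` on `𝒪_w`, its reduction, an element moved by a unit, `|𝓀_w| = q_v²`) are discharged as in ★ `natCard_fixedBy_iwahori_add_one_eq_sum_at`, and the count is
★ `natCard_unitaryTwo_star` + ★ `natCard_antifixed_residueField_eq`. [cite: Serre1980Trees, Ch. II §1.1] [cite: Kottwitz1988, §2] -/
theorem relIndex_iwahori_subgroupOf_glInt_subgroupOf_eq (hunr : Algebra.IsUnramifiedIn (𝓞 L) v.asIdeal) :
    ((iwahoriGL 2 (w.1.adicCompletion L)).subgroupOf
        (unitaryGroupOfForm (galAdicCompletionMap (L := L) (IsCMField.complexConj L) hw)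
          (placeForm (Matrix.of fun i j : Fin 2 => if i.val + j.val + 1 = 2 then (1 : L) else 0) w.1))).relIndex
      ((glInt 2 (w.1.adicCompletion L)).subgroupOf
        (unitaryGroupOfForm (galAdicCompletionMap (L := L) (IsCMField.complexConj L) hw)
          (placeForm (Matrix.of fun i j : Fin 2 => if i.val + j.val + 1 = 2 then (1 : L) else 0) w.1))) =
      Nat.card (𝓞 ↥(maximalRealSubfield L) ⧸ v.asIdeal) + 1 := by
  classical
  have hc1 : IsCMField.complexConj L ≠ 1 := IsCMField.complexConj_ne_one L
  have hJ : placeForm (Matrix.of fun i j : Fin 2 => if i.val + j.val + 1 = 2 then (1 : L) else 0) w.1 = !![(0 : w.1.adicCompletion L), 1; 1, 0] := by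
    ext i j; fin_cases i <;> fin_cases j <;> simp [placeForm, Matrix.map_apply]
  -- the residue data at `w`
  have hϖv := valued_toPlace_uniformizer L v w hunr
  haveI : IsDiscreteValuationRing 𝒪[w.1.adicCompletion L] := isDiscreteValuationRing_integer_of_compatible hϖv
  have hσO : ∀ x : 𝒪[w.1.adicCompletion L], galAdicCompletionMap (L := L) (IsCMField.complexConj L) hw x ∈ 𝒪[w.1.adicCompletion L] :=
    mem_integer_galAdicCompletionMap (IsCMField.complexConj L) v w hw
  let σO : 𝒪[w.1.adicCompletion L] →+* 𝒪[w.1.adicCompletion L] :=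
    ((galAdicCompletionMap (L := L) (IsCMField.complexConj L) hw).comp (𝒪[w.1.adicCompletion L]).subtype).codRestrict 𝒪[w.1.adicCompletion L]
      fun x => hσO x
  have hσO' : ∀ x : 𝒪[w.1.adicCompletion L], ((σO x : 𝒪[w.1.adicCompletion L]) : w.1.adicCompletion L) =
      galAdicCompletionMap (L := L) (IsCMField.complexConj L) hw x := fun _ => rfl
  have hσσ : ∀ x, σO (σO x) = x := fun x =>
    Subtype.ext (galAdicCompletionMap_galAdicCompletionMap_of_smul_eq (IsCMField.complexConj L) w hc1 hw (x : w.1.adicCompletion L))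
  obtain ⟨σk, hσk⟩ := exists_residueField_ringHom_galAdicCompletionMap (IsCMField.complexConj L) v w hw
  have hτ : ∀ x : 𝒪[w.1.adicCompletion L],
      IsLocalRing.residue 𝒪[w.1.adicCompletion L] (σO x) = σk (IsLocalRing.residue 𝒪[w.1.adicCompletion L] x) := fun x => hσk x
  have hq : Nat.card 𝓀[w.1.adicCompletion L] = Nat.card (𝓞 ↥(maximalRealSubfield L) ⧸ v.asIdeal) ^ 2 :=
    natCard_residueField_eq_sq_of_inert (IsCMField.complexConj L) v hc1 hunr w hw
  letI : Fintype 𝓀[w.1.adicCompletion L] := Fintype.ofFinite _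
  have hq' : Fintype.card 𝓀[w.1.adicCompletion L] = Nat.card (𝓞 ↥(maximalRealSubfield L) ⧸ v.asIdeal) ^ 2 := by
    rw [← Nat.card_eq_fintype_card, hq]
  obtain ⟨a₀, ha₀⟩ := Literature.NumberTheory.LocalFields.UnramifiedQuadraticNorm.exists_isUnit_map_sub_of_residueHom_ne
    (galAdicCompletionMap (L := L) (IsCMField.complexConj L) hw) hσO σk hσk
    (Literature.LinearAlgebra.Matrix.exists_frob_ne hq' σk (residueHom_galAdicCompletionMap_eq_pow (IsCMField.complexConj L) v hc1 hunr w hw σk hσO hσk))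
  have ha₀' : IsUnit (σO a₀ - a₀) := ha₀
  have hs : Nat.card {t : 𝓀[w.1.adicCompletion L] // σk t = -t} = Nat.card (𝓞 ↥(maximalRealSubfield L) ⧸ v.asIdeal) :=
    natCard_antifixed_residueField_eq σO hσσ ha₀' σk hτ hq
  -- the star count
  rw [Subgroup.relIndex, Subgroup.index, natCard_unitaryTwo_star (galAdicCompletionMap (L := L) (IsCMField.complexConj L) hw) σO hσO' hσσ ha₀' σk hτ hJ, hs]

end OnePlace
/-! ## §2 The two EP indices on the CM carrier `U(Φ₂)_v` -/

section Indices

variable (L : Type) [Field L] [NumberField L] [IsCMField L] {v : HeightOneSpectrum (𝓞 ↥(maximalRealSubfield L))}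
  (w : PlacesOver L v) (hw : IsCMField.complexConj L • w.1 = w.1)
  (ϖ : (w.1.adicCompletion L)ˣ) (hϖ : Valued.v (ϖ : w.1.adicCompletion L) = WithZero.exp (-1 : ℤ))
  (hσϖ : galAdicCompletionMap (L := L) (IsCMField.complexConj L) hw (ϖ : w.1.adicCompletion L) = ϖ)

include hϖ in
/-- **`[K : I] = q_v + 1`** on `U(Φ₂)_v` at an unramified non-split place: `K = U(Φ₂)(𝒪_v)`, `I = K ⊓ Ad_d K` (`d = diag(1, ϖ)`); transported from §1 along the one-place
model `e_w` (★ `mem_localIntegralLevel_iff_of_smul_eq`, ★ `mem_cmLocalIntegralLevel_inf_map_iff`). [cite: Serre1980Trees, Ch. II §1.1] [cite: Kottwitz1988, §2] -/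
theorem relIndex_inf_map_level_eq (hunr : Algebra.IsUnramifiedIn (𝓞 L) v.asIdeal) :
    (cmLocalIntegralLevel L 2 (Matrix.of fun i j : Fin 2 => if i.val + j.val + 1 = 2 then (1 : L) else 0) v ⊓
        (cmLocalIntegralLevel L 2 (Matrix.of fun i j : Fin 2 => if i.val + j.val + 1 = 2 then (1 : L) else 0) v).map
          (cmDatumLocalNonsplitCongr L w hw (glDiagonal 2 (w.1.adicCompletion L) ![1, ϖ]) ϖ.isUnit
            (formCongr_glDiagonal_eq_smul_two L w hw ϖ hσϖ)).toMulEquiv.toMonoidHom).relIndex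
      (cmLocalIntegralLevel L 2 (Matrix.of fun i j : Fin 2 => if i.val + j.val + 1 = 2 then (1 : L) else 0) v) =
      Nat.card (𝓞 ↥(maximalRealSubfield L) ⧸ v.asIdeal) + 1 := by
  have hc1 : IsCMField.complexConj L ≠ 1 := IsCMField.complexConj_ne_one L
  set e := localNonsplitEquiv (IsCMField.complexConj L) (Matrix.of fun i j : Fin 2 => if i.val + j.val + 1 = 2 then (1 : L) else 0) hc1 w hw with hedef
  have hK : cmLocalIntegralLevel L 2 (Matrix.of fun i j : Fin 2 => if i.val + j.val + 1 = 2 then (1 : L) else 0) v =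
      ((glInt 2 (w.1.adicCompletion L)).subgroupOf
        (unitaryGroupOfForm (galAdicCompletionMap (L := L) (IsCMField.complexConj L) hw)
          (placeForm (Matrix.of fun i j : Fin 2 => if i.val + j.val + 1 = 2 then (1 : L) else 0) w.1))).comap e.toMulEquiv.toMonoidHom :=
    Subgroup.ext fun g =>
      (mem_localIntegralLevel_iff_of_smul_eq (IsCMField.complexConj L) 2 _ hc1 w hw g).trans (Subgroup.mem_subgroupOf.symm.trans (Subgroup.mem_comap (f := e.toMulEquiv.toMonoidHom)).symm)
  have hI : cmLocalIntegralLevel L 2 (Matrix.of fun i j : Fin 2 => if i.val + j.val + 1 = 2 then (1 : L) else 0) v ⊓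
        (cmLocalIntegralLevel L 2 (Matrix.of fun i j : Fin 2 => if i.val + j.val + 1 = 2 then (1 : L) else 0) v).map
          (cmDatumLocalNonsplitCongr L w hw (glDiagonal 2 (w.1.adicCompletion L) ![1, ϖ]) ϖ.isUnit
            (formCongr_glDiagonal_eq_smul_two L w hw ϖ hσϖ)).toMulEquiv.toMonoidHom =
      ((iwahoriGL 2 (w.1.adicCompletion L)).subgroupOf
        (unitaryGroupOfForm (galAdicCompletionMap (L := L) (IsCMField.complexConj L) hw)
          (placeForm (Matrix.of fun i j : Fin 2 => if i.val + j.val + 1 = 2 then (1 : L) else 0) w.1))).comap e.toMulEquiv.toMonoidHom :=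
    Subgroup.ext fun g =>
      (mem_cmLocalIntegralLevel_inf_map_iff L w hw ϖ hϖ hσϖ g).trans (Subgroup.mem_subgroupOf.symm.trans (Subgroup.mem_comap (f := e.toMulEquiv.toMonoidHom)).symm)
  rw [hI, hK]
  exact (relIndex_comap_of_surjective e.surjective _ _).trans (relIndex_iwahori_subgroupOf_glInt_subgroupOf_eq L w hw hunr)

omit [IsCMField L] in
/-- **The `P²`-central trick** for `P = w₀ d`, `w₀ = Φ₂`, `d = diag(1, ϖ)`: `P² = ϖ·1`, so `Ad_{P⁻¹} = Ad_P` and, `w₀` being integral,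
`d⁻¹ (w₀⁻¹ X w₀) d ∈ GL₂(𝒪_w) ↔ d X d⁻¹ ∈ GL₂(𝒪_w)` for every `X ∈ GL₂(L_w)`. [cite: Serre1980Trees, Ch. II §1.1] [cite: IwahoriMatsumoto1965, §2 Prop. 2.4] -/
theorem conj_weylDiag_mem_glInt_iff (w₀ : GL (Fin 2) (w.1.adicCompletion L))
    (hw₀ : (w₀ : Matrix (Fin 2) (Fin 2) (w.1.adicCompletion L)) = !![(0 : w.1.adicCompletion L), 1; 1, 0]) (X : GL (Fin 2) (w.1.adicCompletion L)) :
    (glDiagonal 2 (w.1.adicCompletion L) ![1, ϖ])⁻¹ * (w₀⁻¹ * X * w₀) * glDiagonal 2 (w.1.adicCompletion L) ![1, ϖ] ∈ glInt 2 (w.1.adicCompletion L) ↔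
      glDiagonal 2 (w.1.adicCompletion L) ![1, ϖ] * X * (glDiagonal 2 (w.1.adicCompletion L) ![1, ϖ])⁻¹ ∈ glInt 2 (w.1.adicCompletion L) := by
  have hw₀inv : ((w₀⁻¹ : GL (Fin 2) (w.1.adicCompletion L)) : Matrix (Fin 2) (Fin 2) (w.1.adicCompletion L)) = !![(0 : w.1.adicCompletion L), 1; 1, 0] := by
    rw [Matrix.coe_units_inv, hw₀]
    exact Matrix.inv_eq_left_inv (antidiagTwo_mul_self (F := w.1.adicCompletion L))
  -- `w₀ ∈ GL₂(𝒪_w)`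
  have hint : w₀ ∈ glInt 2 (w.1.adicCompletion L) := by
    refine (mem_glInt_iff_forall_v_le_one_and_v_det_eq_one w₀).2 ⟨fun i j => ?_, ?_⟩
    · rw [hw₀]; fin_cases i <;> fin_cases j <;> simp
    · rw [hw₀]; simp [Matrix.det_fin_two]
  -- `P² = ϖ • 1` is central
  set P : GL (Fin 2) (w.1.adicCompletion L) := w₀ * glDiagonal 2 (w.1.adicCompletion L) ![1, ϖ] with hP
  have hP2 : ((P * P : GL (Fin 2) (w.1.adicCompletion L)) : Matrix (Fin 2) (Fin 2) (w.1.adicCompletion L)) =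
      (ϖ : w.1.adicCompletion L) • (1 : Matrix (Fin 2) (Fin 2) (w.1.adicCompletion L)) := by
    have hdiag : (fun k : Fin 2 => ((![(1 : (w.1.adicCompletion L)ˣ), ϖ] k : (w.1.adicCompletion L)ˣ) : w.1.adicCompletion L)) =
        ![(1 : w.1.adicCompletion L), (ϖ : w.1.adicCompletion L)] := by
      funext k; fin_cases k <;> rfl
    rw [hP, Units.val_mul, Units.val_mul, hw₀, coe_glDiagonal, hdiag, antidiag_mul_diagonal_mul_self, one_mul]
  have hcomm : ∀ Y : GL (Fin 2) (w.1.adicCompletion L), P * P * Y = Y * (P * P) := fun Y => by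
    apply Units.ext
    rw [Units.val_mul, Units.val_mul Y, hP2, Matrix.smul_mul, Matrix.mul_smul, Matrix.one_mul, Matrix.mul_one]
  have hPX : (glDiagonal 2 (w.1.adicCompletion L) ![1, ϖ])⁻¹ * (w₀⁻¹ * X * w₀) * glDiagonal 2 (w.1.adicCompletion L) ![1, ϖ] = P⁻¹ * X * P := by
    rw [hP]; group
  rw [hPX, conj_inv_eq_conj_of_sq_comm hcomm, hP, show w₀ * glDiagonal 2 (w.1.adicCompletion L) ![1, ϖ] * X * (w₀ * glDiagonal 2 (w.1.adicCompletion L) ![1, ϖ])⁻¹ =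
      w₀ * (glDiagonal 2 (w.1.adicCompletion L) ![1, ϖ] * X * (glDiagonal 2 (w.1.adicCompletion L) ![1, ϖ])⁻¹) * w₀⁻¹ by group,
    Subgroup.mul_mem_cancel_right _ ((glInt 2 (w.1.adicCompletion L)).inv_mem hint), Subgroup.mul_mem_cancel_left _ hint]

include hϖ in
/-- **`ψ⁻¹K ⊓ K = w₀ I w₀⁻¹`**: for the similitude transport `ψ = Ad_d` (★ `cmDatumLocalNonsplitCongr`, `e_w(ψ g) = d·e_w(g)·d⁻¹`) and the Weyl element `w₀ ∈ K`
(`e_w(w₀) = Φ₂`): `K.comap ψ ⊓ K = (K ⊓ ψK).map (Ad w₀)` — the Iwahori of the edge `{v₋₁, v₀}` is the `w₀`-conjugate of that of `{v₀, v₁}`.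
[cite: Serre1980Trees, Ch. II §1.1] [cite: IwahoriMatsumoto1965, §2 Prop. 2.4] -/
theorem comap_congr_level_inf_eq_map_conj
    (g₀ : (cmDatum L 2 (Matrix.of fun i j : Fin 2 => if i.val + j.val + 1 = 2 then (1 : L) else 0)).Local v)
    (hg₀ : (((localNonsplitEquiv (IsCMField.complexConj L) (Matrix.of fun i j : Fin 2 => if i.val + j.val + 1 = 2 then (1 : L) else 0)
        (IsCMField.complexConj_ne_one L) w hw g₀ :
        unitaryGroupOfForm (galAdicCompletionMap (L := L) (IsCMField.complexConj L) hw)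
          (placeForm (Matrix.of fun i j : Fin 2 => if i.val + j.val + 1 = 2 then (1 : L) else 0) w.1)) :
        GL (Fin 2) (w.1.adicCompletion L)) : Matrix (Fin 2) (Fin 2) (w.1.adicCompletion L)) = !![(0 : w.1.adicCompletion L), 1; 1, 0]) :
    (cmLocalIntegralLevel L 2 (Matrix.of fun i j : Fin 2 => if i.val + j.val + 1 = 2 then (1 : L) else 0) v).comap
          (cmDatumLocalNonsplitCongr L w hw (glDiagonal 2 (w.1.adicCompletion L) ![1, ϖ]) ϖ.isUnit
            (formCongr_glDiagonal_eq_smul_two L w hw ϖ hσϖ)).toMulEquiv.toMonoidHom ⊓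
        cmLocalIntegralLevel L 2 (Matrix.of fun i j : Fin 2 => if i.val + j.val + 1 = 2 then (1 : L) else 0) v =
      (cmLocalIntegralLevel L 2 (Matrix.of fun i j : Fin 2 => if i.val + j.val + 1 = 2 then (1 : L) else 0) v ⊓
          (cmLocalIntegralLevel L 2 (Matrix.of fun i j : Fin 2 => if i.val + j.val + 1 = 2 then (1 : L) else 0) v).map
            (cmDatumLocalNonsplitCongr L w hw (glDiagonal 2 (w.1.adicCompletion L) ![1, ϖ]) ϖ.isUnit
              (formCongr_glDiagonal_eq_smul_two L w hw ϖ hσϖ)).toMulEquiv.toMonoidHom).map (MulAut.conj g₀).toMonoidHom := by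
  have hc1 : IsCMField.complexConj L ≠ 1 := IsCMField.complexConj_ne_one L
  set e := localNonsplitEquiv (IsCMField.complexConj L) (Matrix.of fun i j : Fin 2 => if i.val + j.val + 1 = 2 then (1 : L) else 0) hc1 w hw with hedef
  set ψ := cmDatumLocalNonsplitCongr L w hw (glDiagonal 2 (w.1.adicCompletion L) ![1, ϖ]) ϖ.isUnit (formCongr_glDiagonal_eq_smul_two L w hw ϖ hσϖ) with hψ
  -- the one-place readings: `E g := e_w(g) ∈ GL₂(L_w)` is multiplicative
  set w₀ : GL (Fin 2) (w.1.adicCompletion L) :=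
    ((e g₀ : unitaryGroupOfForm (galAdicCompletionMap (L := L) (IsCMField.complexConj L) hw)
      (placeForm (Matrix.of fun i j : Fin 2 => if i.val + j.val + 1 = 2 then (1 : L) else 0) w.1)) : GL (Fin 2) (w.1.adicCompletion L)) with hw₀def
  ext g
  set X : GL (Fin 2) (w.1.adicCompletion L) :=
    ((e g : unitaryGroupOfForm (galAdicCompletionMap (L := L) (IsCMField.complexConj L) hw)
      (placeForm (Matrix.of fun i j : Fin 2 => if i.val + j.val + 1 = 2 then (1 : L) else 0) w.1)) : GL (Fin 2) (w.1.adicCompletion L)) with hXdef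
  -- left: `ψ g ∈ K ∧ g ∈ K` read at `w`
  have hL : g ∈ (cmLocalIntegralLevel L 2 (Matrix.of fun i j : Fin 2 => if i.val + j.val + 1 = 2 then (1 : L) else 0) v).comap ψ.toMulEquiv.toMonoidHom ⊓
        cmLocalIntegralLevel L 2 (Matrix.of fun i j : Fin 2 => if i.val + j.val + 1 = 2 then (1 : L) else 0) v ↔
      glDiagonal 2 (w.1.adicCompletion L) ![1, ϖ] * X * (glDiagonal 2 (w.1.adicCompletion L) ![1, ϖ])⁻¹ ∈ glInt 2 (w.1.adicCompletion L) ∧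
        X ∈ glInt 2 (w.1.adicCompletion L) := by
    rw [Subgroup.mem_inf, Subgroup.mem_comap]
    refine and_congr ?_ (mem_localIntegralLevel_iff_of_smul_eq (IsCMField.complexConj L) 2 _ hc1 w hw g)
    rw [← coe_localNonsplitEquiv_cmDatumLocalNonsplitCongr L 2 _ w hw _ ϖ.isUnit (formCongr_glDiagonal_eq_smul_two L w hw ϖ hσϖ) g]
    exact mem_localIntegralLevel_iff_of_smul_eq (IsCMField.complexConj L) 2 _ hc1 w hw _
  -- right: `g₀⁻¹ g g₀ ∈ I` read at `w`
  have hR : g ∈ (cmLocalIntegralLevel L 2 (Matrix.of fun i j : Fin 2 => if i.val + j.val + 1 = 2 then (1 : L) else 0) v ⊓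
          (cmLocalIntegralLevel L 2 (Matrix.of fun i j : Fin 2 => if i.val + j.val + 1 = 2 then (1 : L) else 0) v).map ψ.toMulEquiv.toMonoidHom).map
          (MulAut.conj g₀).toMonoidHom ↔
      w₀⁻¹ * X * w₀ ∈ glInt 2 (w.1.adicCompletion L) ∧
        (glDiagonal 2 (w.1.adicCompletion L) ![1, ϖ])⁻¹ * (w₀⁻¹ * X * w₀) * glDiagonal 2 (w.1.adicCompletion L) ![1, ϖ] ∈ glInt 2 (w.1.adicCompletion L) := by
    rw [Literature.GroupTheory.mem_map_conj_iff, mem_cmLocalIntegralLevel_inf_map_iff L w hw ϖ hϖ hσϖ]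
    have hco : ((e (g₀⁻¹ * g * g₀) : unitaryGroupOfForm (galAdicCompletionMap (L := L) (IsCMField.complexConj L) hw)
          (placeForm (Matrix.of fun i j : Fin 2 => if i.val + j.val + 1 = 2 then (1 : L) else 0) w.1)) : GL (Fin 2) (w.1.adicCompletion L)) =
        w₀⁻¹ * X * w₀ := by
      have h1 : e (g₀⁻¹ * g * g₀) = (e g₀)⁻¹ * e g * e g₀ :=
        (map_mul e _ _).trans (congrArg (· * e g₀) ((map_mul e _ _).trans (congrArg (· * e g) (map_inv e g₀))))
      exact congrArg Subtype.val h1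
    rw [hco, ← glInt_inf_map_conj_glDiagonal_eq_iwahoriGL_of_valued_eq w.1 ϖ hϖ, Subgroup.mem_inf, Literature.GroupTheory.mem_map_conj_iff]
  rw [hL, hR, conj_weylDiag_mem_glInt_iff L w ϖ w₀ hg₀ X, and_comm]
  -- `w₀⁻¹ X w₀ ∈ GL₂(𝒪) ↔ X ∈ GL₂(𝒪)`
  have hint : w₀ ∈ glInt 2 (w.1.adicCompletion L) := by
    refine (mem_glInt_iff_forall_v_le_one_and_v_det_eq_one w₀).2 ⟨fun i j => ?_, ?_⟩
    · rw [hg₀]; fin_cases i <;> fin_cases j <;> simp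
    · rw [hg₀]; simp [Matrix.det_fin_two]
  rw [Subgroup.mul_mem_cancel_right _ hint, Subgroup.mul_mem_cancel_left _ ((glInt 2 (w.1.adicCompletion L)).inv_mem hint)]

include hϖ in
/-- **`[K′ : I] = q_v + 1`** on `U(Φ₂)_v` at an unramified non-split place (`K′ = Ad_d K`, `I = K ⊓ K′`): `[ψK : K ⊓ ψK] = [K : ψ⁻¹K ⊓ K] = [K : w₀ I w₀⁻¹] = [K : I]`.
[cite: Serre1980Trees, Ch. II §1.1] [cite: Kottwitz1988, §2] -/
theorem relIndex_inf_map_congrLevel_eq (hunr : Algebra.IsUnramifiedIn (𝓞 L) v.asIdeal) :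
    (cmLocalIntegralLevel L 2 (Matrix.of fun i j : Fin 2 => if i.val + j.val + 1 = 2 then (1 : L) else 0) v ⊓
        (cmLocalIntegralLevel L 2 (Matrix.of fun i j : Fin 2 => if i.val + j.val + 1 = 2 then (1 : L) else 0) v).map
          (cmDatumLocalNonsplitCongr L w hw (glDiagonal 2 (w.1.adicCompletion L) ![1, ϖ]) ϖ.isUnit
            (formCongr_glDiagonal_eq_smul_two L w hw ϖ hσϖ)).toMulEquiv.toMonoidHom).relIndex
      ((cmLocalIntegralLevel L 2 (Matrix.of fun i j : Fin 2 => if i.val + j.val + 1 = 2 then (1 : L) else 0) v).map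
          (cmDatumLocalNonsplitCongr L w hw (glDiagonal 2 (w.1.adicCompletion L) ![1, ϖ]) ϖ.isUnit
            (formCongr_glDiagonal_eq_smul_two L w hw ϖ hσϖ)).toMulEquiv.toMonoidHom) =
      Nat.card (𝓞 ↥(maximalRealSubfield L) ⧸ v.asIdeal) + 1 := by
  classical
  have hc1 : IsCMField.complexConj L ≠ 1 := IsCMField.complexConj_ne_one L
  set e := localNonsplitEquiv (IsCMField.complexConj L) (Matrix.of fun i j : Fin 2 => if i.val + j.val + 1 = 2 then (1 : L) else 0) hc1 w hw with hedef
  set ψ := cmDatumLocalNonsplitCongr L w hw (glDiagonal 2 (w.1.adicCompletion L) ![1, ϖ]) ϖ.isUnit (formCongr_glDiagonal_eq_smul_two L w hw ϖ hσϖ) with hψ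
  set K := cmLocalIntegralLevel L 2 (Matrix.of fun i j : Fin 2 => if i.val + j.val + 1 = 2 then (1 : L) else 0) v with hKdef
  -- the Weyl element `w₀ ∈ K`, `e_w(w₀) = Φ₂`
  have hJ : placeForm (Matrix.of fun i j : Fin 2 => if i.val + j.val + 1 = 2 then (1 : L) else 0) w.1 = !![(0 : w.1.adicCompletion L), 1; 1, 0] := by
    ext i j; fin_cases i <;> fin_cases j <;> simp [placeForm, Matrix.map_apply]
  have hJJ := antidiagTwo_mul_self (F := w.1.adicCompletion L)
  set W : GL (Fin 2) (w.1.adicCompletion L) := ⟨_, _, hJJ, hJJ⟩ with hW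
  have hWU : W ∈ unitaryGroupOfForm (galAdicCompletionMap (L := L) (IsCMField.complexConj L) hw)
      (placeForm (Matrix.of fun i j : Fin 2 => if i.val + j.val + 1 = 2 then (1 : L) else 0) w.1) := by
    rw [mem_unitaryGroupOfForm_iff, hJ]; exact antidiagTwo_unitary _
  set g₀ : (cmDatum L 2 (Matrix.of fun i j : Fin 2 => if i.val + j.val + 1 = 2 then (1 : L) else 0)).Local v := e.symm ⟨W, hWU⟩ with hg₀def
  have hg₀ : (((e g₀ : unitaryGroupOfForm (galAdicCompletionMap (L := L) (IsCMField.complexConj L) hw)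
        (placeForm (Matrix.of fun i j : Fin 2 => if i.val + j.val + 1 = 2 then (1 : L) else 0) w.1)) :
        GL (Fin 2) (w.1.adicCompletion L)) : Matrix (Fin 2) (Fin 2) (w.1.adicCompletion L)) = !![(0 : w.1.adicCompletion L), 1; 1, 0] := by
    rw [hg₀def, ContinuousMulEquiv.apply_symm_apply]
  have hg₀K : g₀ ∈ K := by
    refine (mem_localIntegralLevel_iff_of_smul_eq (IsCMField.complexConj L) 2 _ hc1 w hw g₀).2
      ((mem_glInt_iff_forall_v_le_one_and_v_det_eq_one _).2 ⟨fun i j => ?_, ?_⟩)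
    · rw [hg₀]; fin_cases i <;> fin_cases j <;> simp
    · rw [hg₀]; simp [Matrix.det_fin_two]
  -- `[ψK : K ⊓ ψK] = [K : ψ⁻¹K ⊓ K] = [K : w₀ I w₀⁻¹] = [K : I]`
  have hinj : Function.Injective ψ.toMulEquiv.toMonoidHom := ψ.injective
  calc (K ⊓ K.map ψ.toMulEquiv.toMonoidHom).relIndex (K.map ψ.toMulEquiv.toMonoidHom)
      = ((K ⊓ K.map ψ.toMulEquiv.toMonoidHom).comap ψ.toMulEquiv.toMonoidHom).relIndex K := (Subgroup.relIndex_comap (K ⊓ K.map ψ.toMulEquiv.toMonoidHom) ψ.toMulEquiv.toMonoidHom K).symm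
    _ = (K.comap ψ.toMulEquiv.toMonoidHom ⊓ K).relIndex K := by rw [Subgroup.comap_inf, Subgroup.comap_map_eq_self_of_injective hinj]
    _ = ((K ⊓ K.map ψ.toMulEquiv.toMonoidHom).map (MulAut.conj g₀).toMonoidHom).relIndex K := by
        rw [comap_congr_level_inf_eq_map_conj L w hw ϖ hϖ hσϖ g₀ hg₀]
    _ = ((K ⊓ K.map ψ.toMulEquiv.toMonoidHom).map (MulAut.conj g₀).toMonoidHom).relIndex (K.map (MulAut.conj g₀).toMonoidHom) := by
        rw [map_conj_eq_self_of_mem K hg₀K]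
    _ = (K ⊓ K.map ψ.toMulEquiv.toMonoidHom).relIndex K := Subgroup.relIndex_map_map_of_injective _ _ (MulAut.conj g₀).injective
    _ = Nat.card (𝓞 ↥(maximalRealSubfield L) ⧸ v.asIdeal) + 1 := relIndex_inf_map_level_eq L w hw ϖ hϖ hσϖ hunr

end Indices
/-! ## §3 LETTER E of the (u)-assembly: the EP datum with `r · ν(K) = q_v − 1` -/

section Letter

variable (L : Type) [Field L] [NumberField L] [IsCMField L] {v : HeightOneSpectrum (𝓞 ↥(maximalRealSubfield L))}
  [MeasurableSpace ((cmDatum L 2 (Matrix.of fun i j : Fin 2 => if i.val + j.val + 1 = 2 then (1 : L) else 0)).Local v)]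
  [BorelSpace ((cmDatum L 2 (Matrix.of fun i j : Fin 2 => if i.val + j.val + 1 = 2 then (1 : L) else 0)).Local v)]
  [∀ γ : (cmDatum L 2 (Matrix.of fun i j : Fin 2 => if i.val + j.val + 1 = 2 then (1 : L) else 0)).Local v,
    MeasurableSpace (((cmDatum L 2 (Matrix.of fun i j : Fin 2 => if i.val + j.val + 1 = 2 then (1 : L) else 0)).Local v) ⧸
      Subgroup.centralizer ({γ} : Set ((cmDatum L 2 (Matrix.of fun i j : Fin 2 => if i.val + j.val + 1 = 2 then (1 : L) else 0)).Local v)))]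
  [∀ γ : (cmDatum L 2 (Matrix.of fun i j : Fin 2 => if i.val + j.val + 1 = 2 then (1 : L) else 0)).Local v,
    BorelSpace (((cmDatum L 2 (Matrix.of fun i j : Fin 2 => if i.val + j.val + 1 = 2 then (1 : L) else 0)).Local v) ⧸
      Subgroup.centralizer ({γ} : Set ((cmDatum L 2 (Matrix.of fun i j : Fin 2 => if i.val + j.val + 1 = 2 then (1 : L) else 0)).Local v)))]
  (ν : Measure ((cmDatum L 2 (Matrix.of fun i j : Fin 2 => if i.val + j.val + 1 = 2 then (1 : L) else 0)).Local v))
  [IsHaarMeasure ν] [ν.IsMulRightInvariant]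

/-- **LETTER E WITH THE EXPLICIT UNIFORMISER** (and the by-products): for `v` unramified non-split, `ϖ ∈ L_w` a `σ_w`-fixed uniformiser, any two-sided Haar `ν` and
canonical `m` on `U(Φ₂)_v`: `∃ f₂ r`, ‹J3›'s four EP fields, `0 < r` and `r · ν(↑K).toReal = q_v − 1` (`[K:I] = [K′:I] = q_v + 1` fed into ★ F5's index form).
[cite: Kottwitz1988, §2 Theorem 2] [cite: Serre1980Trees, Ch. II §1.1] [cite: Rogawski1990, §8.1 p. 117; §12.6 p. 174] -/
theorem exists_epDatum_of_unramified' (w : PlacesOver L v) (hw : IsCMField.complexConj L • w.1 = w.1)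
    (ϖ : (w.1.adicCompletion L)ˣ) (hϖ : Valued.v (ϖ : w.1.adicCompletion L) = WithZero.exp (-1 : ℤ))
    (hσϖ : galAdicCompletionMap (L := L) (IsCMField.complexConj L) hw (ϖ : w.1.adicCompletion L) = ϖ)
    (hunr : Algebra.IsUnramifiedIn (𝓞 L) v.asIdeal)
    {m : OrbitalMeasureFamily ((cmDatum L 2 (Matrix.of fun i j : Fin 2 => if i.val + j.val + 1 = 2 then (1 : L) else 0)).Local v)}
    (hm : m.IsCanonical (fun γ => IsRegularElt (γ.val : GL (Fin 2) (UnitaryGroup.LocalRing L v))) ν) :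
    ∃ (f₂ : ((cmDatum L 2 (Matrix.of fun i j : Fin 2 => if i.val + j.val + 1 = 2 then (1 : L) else 0)).Local v) → ℂ) (r : ℝ), IsLocSmooth f₂ ∧
      (∀ γ : (cmDatum L 2 (Matrix.of fun i j : Fin 2 => if i.val + j.val + 1 = 2 then (1 : L) else 0)).Local v,
          IsRegularElt (γ.val : GL (Fin 2) (UnitaryGroup.LocalRing L v)) →
          CompactSpace (Subgroup.centralizer ({γ} : Set ((cmDatum L 2 (Matrix.of fun i j : Fin 2 => if i.val + j.val + 1 = 2 then (1 : L) else 0)).Local v))) →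
          classOrbitalIntegral m f₂ (ConjClasses.mk γ) = 1) ∧
      (∀ γ : (cmDatum L 2 (Matrix.of fun i j : Fin 2 => if i.val + j.val + 1 = 2 then (1 : L) else 0)).Local v,
          IsRegularElt (γ.val : GL (Fin 2) (UnitaryGroup.LocalRing L v)) →
          ¬ CompactSpace (Subgroup.centralizer ({γ} : Set ((cmDatum L 2 (Matrix.of fun i j : Fin 2 => if i.val + j.val + 1 = 2 then (1 : L) else 0)).Local v))) →
          classOrbitalIntegral m f₂ (ConjClasses.mk γ) = 0) ∧
      (∀ (z : (cmDatum L 2 (Matrix.of fun i j : Fin 2 => if i.val + j.val + 1 = 2 then (1 : L) else 0)).Local v) (b : LocalRing L v),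
          ((z.val : GL (Fin 2) (LocalRing L v)).val : Matrix (Fin 2) (Fin 2) (LocalRing L v)) = b • (1 : Matrix (Fin 2) (Fin 2) (LocalRing L v)) →
          f₂ z = -(r : ℂ)) ∧
      0 < r ∧
      r * (ν (cmLocalIntegralLevel L 2 (Matrix.of fun i j : Fin 2 => if i.val + j.val + 1 = 2 then (1 : L) else 0) v :
          Set ((cmDatum L 2 (Matrix.of fun i j : Fin 2 => if i.val + j.val + 1 = 2 then (1 : L) else 0)).Local v))).toReal =
        (Nat.card (𝓞 ↥(maximalRealSubfield L) ⧸ v.asIdeal) : ℝ) - 1 := by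
  obtain ⟨f₂, r, hf, h1, h0, hval, hr, -, hK⟩ := exists_epDatum_indexForm_of_unramified L w hw ϖ hϖ hσϖ ν hunr hm
  rw [relIndex_inf_map_level_eq L w hw ϖ hϖ hσϖ hunr, relIndex_inf_map_congrLevel_eq L w hw ϖ hϖ hσϖ hunr] at hK
  set q : ℕ := Nat.card (𝓞 ↥(maximalRealSubfield L) ⧸ v.asIdeal) with hq
  have hq1 : (q : ℂ) + 1 ≠ 0 := Nat.cast_add_one_ne_zero q
  refine ⟨f₂, r, hf, h1, h0, hval, hr, ?_⟩
  have h : (r : ℂ) * ((ν (cmLocalIntegralLevel L 2 (Matrix.of fun i j : Fin 2 => if i.val + j.val + 1 = 2 then (1 : L) else 0) v :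
        Set ((cmDatum L 2 (Matrix.of fun i j : Fin 2 => if i.val + j.val + 1 = 2 then (1 : L) else 0)).Local v))).toReal : ℂ) = (q : ℂ) - 1 := by
    rw [hK]; push_cast; field_simp; ring
  exact_mod_cast h

/-- **LETTER E OF THE (u)-ASSEMBLY (road owner K2E3-p15 (g2), `SKELETON-J3u-inert` S1), VERBATIM SHAPE.**  For `v` unramified and non-split in `L` (`w ∣ v`, `w̄ = w`), any
two-sided Haar measure `ν₂` and canonical orbital measures `m₂` on `U(Φ₂)_v`, there are `f₂ ∈ C_c^∞(U(Φ₂)_v)` and `r : ℝ` with orbital integrals `1 ∕ 0` on the regular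
elliptic ∕ split classes, `f₂(b·1) = −r` at the central unit scalars, and **`r · ν₂(↑K₂).toReal = q_v − 1`**, `K₂ = U(Φ₂)(𝒪_v)`, `q_v = |𝓞_{L⁺} ∕ v|` — Kottwitz's EP function
of the `(q_v+1)`-regular tree: `r · ν₂(I) = 1 − 2∕(q_v+1)`, `ν₂(K₂) = (q_v+1) · ν₂(I)`.  (The `σ_w`-fixed uniformiser `ι_w(ϖ_v)` is chosen inside; no `2 ∉ v` guard.)
[cite: Kottwitz1988, §2 Theorem 2] [cite: Serre1980Trees, Ch. II §1.1] [cite: Rogawski1990, §8.1 p. 117; §12.6 p. 174] -/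
theorem exists_epDatum_of_unramified (w : PlacesOver L v) (hw : IsCMField.complexConj L • w.1 = w.1) (hunr : Algebra.IsUnramifiedIn (𝓞 L) v.asIdeal)
    {m : OrbitalMeasureFamily ((cmDatum L 2 (Matrix.of fun i j : Fin 2 => if i.val + j.val + 1 = 2 then (1 : L) else 0)).Local v)}
    (hm : m.IsCanonical (fun γ => IsRegularElt (γ.val : GL (Fin 2) (UnitaryGroup.LocalRing L v))) ν) :
    ∃ (f₂ : ((cmDatum L 2 (Matrix.of fun i j : Fin 2 => if i.val + j.val + 1 = 2 then (1 : L) else 0)).Local v) → ℂ) (r : ℝ), IsLocSmooth f₂ ∧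
      (∀ γ : (cmDatum L 2 (Matrix.of fun i j : Fin 2 => if i.val + j.val + 1 = 2 then (1 : L) else 0)).Local v,
          IsRegularElt (γ.val : GL (Fin 2) (UnitaryGroup.LocalRing L v)) →
          CompactSpace (Subgroup.centralizer ({γ} : Set ((cmDatum L 2 (Matrix.of fun i j : Fin 2 => if i.val + j.val + 1 = 2 then (1 : L) else 0)).Local v))) →
          classOrbitalIntegral m f₂ (ConjClasses.mk γ) = 1) ∧
      (∀ γ : (cmDatum L 2 (Matrix.of fun i j : Fin 2 => if i.val + j.val + 1 = 2 then (1 : L) else 0)).Local v,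
          IsRegularElt (γ.val : GL (Fin 2) (UnitaryGroup.LocalRing L v)) →
          ¬ CompactSpace (Subgroup.centralizer ({γ} : Set ((cmDatum L 2 (Matrix.of fun i j : Fin 2 => if i.val + j.val + 1 = 2 then (1 : L) else 0)).Local v))) →
          classOrbitalIntegral m f₂ (ConjClasses.mk γ) = 0) ∧
      (∀ (z : (cmDatum L 2 (Matrix.of fun i j : Fin 2 => if i.val + j.val + 1 = 2 then (1 : L) else 0)).Local v) (b : LocalRing L v),
          ((z.val : GL (Fin 2) (LocalRing L v)).val : Matrix (Fin 2) (Fin 2) (LocalRing L v)) = b • (1 : Matrix (Fin 2) (Fin 2) (LocalRing L v)) →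
          f₂ z = -(r : ℂ)) ∧
      r * (ν (cmLocalIntegralLevel L 2 (Matrix.of fun i j : Fin 2 => if i.val + j.val + 1 = 2 then (1 : L) else 0) v :
          Set ((cmDatum L 2 (Matrix.of fun i j : Fin 2 => if i.val + j.val + 1 = 2 then (1 : L) else 0)).Local v))).toReal =
        (Nat.card (𝓞 ↥(maximalRealSubfield L) ⧸ v.asIdeal) : ℝ) - 1 := by
  obtain ⟨f₂, r, hf, h1, h0, hval, -, hK⟩ := exists_epDatum_of_unramified' L ν w hw (Units.mk0 _ (toPlace_uniformizer_ne_zero L v w hunr))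
    (valued_toPlace_uniformizer L v w hunr) (galAdicCompletionMap_toPlace_self L v w hw _) hunr hm
  exact ⟨f₂, r, hf, h1, h0, hval, hK⟩

end Letter

end Summit.HodgeConjecture.HodgeConjecture.Cruxes.H413.K2E3EPIndicesUnramified

end
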